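import Summits.AtomisticToContinuum.Crystallization.Theorems.ExcessDecayLiouvilleLinearisedEquation
import Summits.AtomisticToContinuum.Crystallization.Theorems.ExcessDecayLiouvilleEquationBounds
import Summits.AtomisticToContinuum.Crystallization.Theorems.ExcessDecayLiouvilleTwoLatticeForce

/-!
# Route `ExcessDecayLiouville`: consistency — the reference force of the datum is `O(ε + depth⁻⁴)`

Step (b) of the excess-decay argument for item `ExcessDecay` (stmt-AtomisticToContinuum-9334).  If a finite
`δ`-separated Lennard-Jones equilibrium `X` is two-way `ε`-matched (`ε ≤ 1/20`, `2ε < δ`) with the site set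
of an admissible datum `(t, A)` on the ball `dist · c ≤ r`, then at every site `s` of the ball of depth
`r − dist s c ≥ 1 + 2ε ∨ δ + 2ε` the FULL reference force of the perfect two-lattice,
`F_∞(s) = Σ'_{q ∈ S, q ≠ s} (V′(|s−q|)/|s−q|)(s−q)` (constant on sublattices, `refForce_add`, and opposite on
the two sublattices, `refForce_zero_add_refForce_one`), is small:

`‖F_∞(s)‖ ≤ 2048/((23/25)³(r − dist s c)⁴) + 24000·ε²·1024/(23/25)⁹ + 76·ε·1024/(23/25)⁸ + 2048/(δ³(r − dist s c − 2ε)⁴)`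

(`norm_refForce_le_of_matched`): reference truncation (force tail over the sites outside the ball) +
nonlinear remainder (`norm_linearised_equation_le`) + truncated force-constant operator applied to the
`ε`-small displacement (`norm_truncOperator_le`) + exterior particles (`sum_norm_rest_le`).  Consequence for
the proof of `ExcessDecay`: only data whose optical reference force is `O(ε + r⁻⁴)` can occur, and that
offset is absorbed by the free sublattice translations `t′`.  All `[folklore]`; nothing here closes an item.
-/

noncomputable section

namespace Summit.AtomisticToContinuum.Crystallization.Theorems.ExcessDecayLiouville

open scoped BigOperators Topology InnerProductSpace RealInnerProductSpace
open Literature.MathematicalPhysics.StatisticalMechanics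
open Summit.AtomisticToContinuum.Crystallization.Theorems.PhononStabilityNegative

section

variable {X : Set (EuclideanSpace ℝ (Fin 3))} {c : EuclideanSpace ℝ (Fin 3)} {r ε δ : ℝ}
  {t : Fin 2 → EuclideanSpace ℝ (Fin 3)} {A : EuclideanSpace ℝ (Fin 3) →L[ℝ] EuclideanSpace ℝ (Fin 3)}
  {π : EuclideanSpace ℝ (Fin 3) → EuclideanSpace ℝ (Fin 3)}

/-- **Reference truncation**: the part of the reference force `F_∞(s)` coming from the sites OUTSIDE the
ball `dist · c ≤ r` has norm `≤ 2048/((23/25)³(r − dist s c)⁴)` when `r − dist s c ≥ 1` (those sites are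
at distance `> r − dist s c` from `s`; force tail over the `23/25`-separated site set). [folklore] -/
theorem norm_refForce_sub_trunc_le (hA : Adm₀ A) (hI : Inner₀ t A) {s : EuclideanSpace ℝ (Fin 3)}
    (hs : s ∈ Sites₀ t A) (hR1 : 1 ≤ r - dist s c)
    (SR : Finset (EuclideanSpace ℝ (Fin 3))) (hSR : ∀ x, x ∈ SR ↔ x ∈ Sites₀ t A ∧ dist x c ≤ r) :
    ‖(∑' q : {q : EuclideanSpace ℝ (Fin 3) // q ∈ Sites₀ t A ∧ q ≠ s},
        (deriv lennardJones (dist s q) / dist s q) • (s - (q : EuclideanSpace ℝ (Fin 3)))) -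
      ∑ q ∈ SR.erase s, (deriv lennardJones (dist s q) / dist s q) • (s - q)‖ ≤
      2048 / ((23 / 25 : ℝ) ^ 3 * (r - dist s c) ^ 4) := by
  classical
  -- the summand as a function of the other site
  set g : EuclideanSpace ℝ (Fin 3) → EuclideanSpace ℝ (Fin 3) :=
    fun q => (deriv lennardJones (dist s q) / dist s q) • (s - q) with hg
  have hsum : Summable (fun q : {q : EuclideanSpace ℝ (Fin 3) // q ∈ Sites₀ t A ∧ q ≠ s} =>
      g (q : EuclideanSpace ℝ (Fin 3))) := summable_refForce hA hI hs
  -- the truncated sum as a sum over a Finset of the index subtype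
  set FT : Finset {q : EuclideanSpace ℝ (Fin 3) // q ∈ Sites₀ t A ∧ q ≠ s} :=
    (SR.erase s).subtype (fun q => q ∈ Sites₀ t A ∧ q ≠ s) with hFT
  have htrunc : ∑ x ∈ FT, g (x : EuclideanSpace ℝ (Fin 3)) = ∑ q ∈ SR.erase s, g q := by
    rw [hFT, Finset.sum_subtype_eq_sum_filter]
    refine Finset.sum_congr (Finset.filter_true_of_mem fun q hq => ?_) fun _ _ => rfl
    exact ⟨((hSR q).1 (Finset.mem_of_mem_erase hq)).1, Finset.ne_of_mem_erase hq⟩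
  have hsplit := hsum.sum_add_tsum_subtype_compl FT
  rw [htrunc] at hsplit
  have hdiff : (∑' q : {q : EuclideanSpace ℝ (Fin 3) // q ∈ Sites₀ t A ∧ q ≠ s},
      g (q : EuclideanSpace ℝ (Fin 3))) - ∑ q ∈ SR.erase s, g q =
      ∑' x : {x : {q : EuclideanSpace ℝ (Fin 3) // q ∈ Sites₀ t A ∧ q ≠ s} // x ∉ FT},
        g ((x : {q : EuclideanSpace ℝ (Fin 3) // q ∈ Sites₀ t A ∧ q ≠ s}) : EuclideanSpace ℝ (Fin 3)) := by
    rw [← hsplit, add_sub_cancel_left]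
  rw [hdiff]
  -- norms
  have hsumn : Summable (fun x : {x : {q : EuclideanSpace ℝ (Fin 3) // q ∈ Sites₀ t A ∧ q ≠ s} // x ∉ FT} =>
      ‖g ((x : {q : EuclideanSpace ℝ (Fin 3) // q ∈ Sites₀ t A ∧ q ≠ s}) : EuclideanSpace ℝ (Fin 3))‖) :=
    (summable_norm_refForce hA hI hs).subtype {x | x ∉ FT}
  refine (norm_tsum_le_tsum_norm hsumn).trans ?_
  -- bound every finite partial sum by the force tail over the sites at distance ≥ r − dist s c from s
  have hsep : ∀ a ∈ Sites₀ t A, ∀ b ∈ Sites₀ t A, a ≠ b → (23 / 25 : ℝ) ≤ dist a b :=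
    fun a ha b hb hab => dist_sites_ge hA hI ha hb hab
  have hRδ : (23 / 25 : ℝ) ≤ r - dist s c := by linarith
  have hfar : ∀ x : {x : {q : EuclideanSpace ℝ (Fin 3) // q ∈ Sites₀ t A ∧ q ≠ s} // x ∉ FT},
      r - dist s c ≤ dist ((x.1 : {q : EuclideanSpace ℝ (Fin 3) // q ∈ Sites₀ t A ∧ q ≠ s}) :
        EuclideanSpace ℝ (Fin 3)) s := by
    intro x
    have hx1 : ((x.1 : {q : EuclideanSpace ℝ (Fin 3) // q ∈ Sites₀ t A ∧ q ≠ s}) : EuclideanSpace ℝ (Fin 3)) ∉ SR := by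
      intro h
      exact x.2 (Finset.mem_subtype.2 (Finset.mem_erase.2 ⟨x.1.2.2, h⟩))
    have hxc : ¬ dist ((x.1 : {q : EuclideanSpace ℝ (Fin 3) // q ∈ Sites₀ t A ∧ q ≠ s}) :
        EuclideanSpace ℝ (Fin 3)) c ≤ r := fun h => hx1 ((hSR _).2 ⟨x.1.2.1, h⟩)
    have := dist_triangle ((x.1 : {q : EuclideanSpace ℝ (Fin 3) // q ∈ Sites₀ t A ∧ q ≠ s}) :
        EuclideanSpace ℝ (Fin 3)) s c
    linarith
  refine Real.tsum_le_of_sum_le (fun _ => norm_nonneg _) fun u => ?_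
  -- map the finite set of indices to a finite set of sites
  let emb : {x : {q : EuclideanSpace ℝ (Fin 3) // q ∈ Sites₀ t A ∧ q ≠ s} // x ∉ FT} ↪ EuclideanSpace ℝ (Fin 3) :=
    ⟨fun x => ((x.1 : {q : EuclideanSpace ℝ (Fin 3) // q ∈ Sites₀ t A ∧ q ≠ s}) : EuclideanSpace ℝ (Fin 3)),
      fun a b h => Subtype.ext (Subtype.ext h)⟩
  have hmap : ∑ x ∈ u, ‖g ((x : {q : EuclideanSpace ℝ (Fin 3) // q ∈ Sites₀ t A ∧ q ≠ s}) : EuclideanSpace ℝ (Fin 3))‖ =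
      ∑ q ∈ u.map emb, ‖g q‖ := by
    rw [Finset.sum_map]
    rfl
  rw [hmap]
  refine sum_norm_ljForce_le_of_separated (u.map emb) s (by norm_num : (0 : ℝ) < 23 / 25) hRδ hR1 ?_ ?_
  · intro a ha b hb hab
    rw [Finset.mem_map] at ha hb
    obtain ⟨a', -, rfl⟩ := ha
    obtain ⟨b', -, rfl⟩ := hb
    exact hsep _ a'.1.2.1 _ b'.1.2.1 hab
  · intro a ha
    rw [Finset.mem_map] at ha
    obtain ⟨a', -, rfl⟩ := ha
    exact hfar a'

/-- **Consistency: the reference force of an `ε`-matched datum is `O(ε + depth⁻⁴)`.**  See the module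
docstring.  Hypotheses: admissible datum; `X` finite, `δ`-separated, two-way `ε`-matched on the ball
(`hXb`, `hπ`, `hinj` from `exists_matching`), force balance at the matched particle `π s`
(`hEq`, the route's `Equil`), `0 ≤ ε ≤ 1/20`, `2ε < δ`, depth conditions `hR1`, `hRδ`. [folklore] -/
theorem norm_refForce_le_of_matched (hA : Adm₀ A) (hI : Inner₀ t A) (hX : X.Finite)
    (hsep : ∀ p ∈ X, ∀ q ∈ X, p ≠ q → δ ≤ dist p q) (hδ : 0 < δ) (hε0 : 0 ≤ ε) (hε2 : 2 * ε < δ)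
    (hε : ε ≤ 1 / 20)
    (hXb : ∀ p ∈ X, dist p c ≤ r → ∃ m : Fin 2, ∃ z ∈ Λ₀, dist p (t m + A z) ≤ ε)
    (hπ : ∀ s' ∈ Sites₀ t A, dist s' c ≤ r → π s' ∈ X ∧ dist (π s') s' ≤ ε)
    (hinj : ∀ s₁ ∈ Sites₀ t A, ∀ s₂ ∈ Sites₀ t A, dist s₁ c ≤ r → dist s₂ c ≤ r → π s₁ = π s₂ → s₁ = s₂)
    {s : EuclideanSpace ℝ (Fin 3)} (hs : s ∈ Sites₀ t A) (hsc : dist s c ≤ r)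
    (hR1 : 1 ≤ r - dist s c - 2 * ε) (hRδ : δ ≤ r - dist s c - 2 * ε)
    (SR : Finset (EuclideanSpace ℝ (Fin 3))) (hSR : ∀ x, x ∈ SR ↔ x ∈ Sites₀ t A ∧ dist x c ≤ r)
    (hEq : HasSum (fun q : {q : EuclideanSpace ℝ (Fin 3) // q ∈ X ∧ q ≠ π s} =>
      (deriv lennardJones (dist (π s) q) / dist (π s) q) • (π s - (q : EuclideanSpace ℝ (Fin 3)))) 0) :
    ‖∑' q : {q : EuclideanSpace ℝ (Fin 3) // q ∈ Sites₀ t A ∧ q ≠ s},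
        (deriv lennardJones (dist s q) / dist s q) • (s - (q : EuclideanSpace ℝ (Fin 3)))‖ ≤
      2048 / ((23 / 25 : ℝ) ^ 3 * (r - dist s c) ^ 4) +
        6000 * (2 * ε) ^ 2 * (1024 / ((23 / 25 : ℝ) ^ 3 * (23 / 25 : ℝ) ^ 6)) +
        76 * ε * (1024 / ((23 / 25 : ℝ) ^ 3 * (23 / 25 : ℝ) ^ 5)) +
        2048 / (δ ^ 3 * (r - dist s c - 2 * ε) ^ 4) := by
  classical
  have hSRS : ∀ x ∈ SR, x ∈ Sites₀ t A := fun x hx => ((hSR x).1 hx).1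
  have hsSR : s ∈ SR := (hSR s).2 ⟨hs, hsc⟩
  set Rest := (hX.toFinset.erase (π s)) \ ((SR.erase s).image π) with hRestdef
  -- (1) the linearised equation
  have hlin := norm_linearised_equation_le hA hI hX hπ hinj hε hs hsc SR hSR hEq
  rw [← hRestdef] at hlin
  -- (2) the operator term
  have hL := norm_truncOperator_le hA hI hs SR hSRS hsSR (fun x => π x - x)
    (fun x hx => by rw [← dist_eq_norm]; exact (hπ x ((hSR x).1 hx).1 ((hSR x).1 hx).2).2)
  have hL' := hL.trans (mul_le_mul_of_nonneg_left (sum_inv_pow_sites_le hA hI hs SR hSRS (k := 5) (by norm_num))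
    (by positivity))
  -- (3) the remainder sum
  have hN : 6000 * (2 * ε) ^ 2 * ∑ s' ∈ SR.erase s, (‖s - s'‖⁻¹) ^ 9 ≤
      6000 * (2 * ε) ^ 2 * (1024 / ((23 / 25 : ℝ) ^ 3 * (23 / 25 : ℝ) ^ 6)) :=
    mul_le_mul_of_nonneg_left (sum_inv_pow_sites_le hA hI hs SR hSRS (k := 6) (by norm_num)) (by positivity)
  -- (4) the exterior
  have hRestX : ∀ q ∈ Rest, q ∈ X := by
    intro q hq
    rw [hRestdef, Finset.mem_sdiff, Finset.mem_erase, Set.Finite.mem_toFinset] at hq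
    exact hq.1.2
  have hRest : ∀ q ∈ Rest, ∀ s' ∈ Sites₀ t A, dist s' c ≤ r → π s' ≠ q := by
    intro q hq s' hs' hs'c hq'
    rw [hRestdef, Finset.mem_sdiff, Finset.mem_erase] at hq
    obtain ⟨⟨hne, -⟩, hnot⟩ := hq
    by_cases hss : s' = s
    · exact hne (by rw [← hq', hss])
    · exact hnot (Finset.mem_image.2 ⟨s', Finset.mem_erase.2 ⟨hss, (hSR s').2 ⟨hs', hs'c⟩⟩, hq'⟩)
  have hE := sum_norm_rest_le hsep hδ hε0 hε2 hXb hπ hs hsc hR1 hRδ Rest hRestX hRest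
  have hE' : ‖∑ q ∈ Rest, (deriv lennardJones (dist (π s) q) / dist (π s) q) • (π s - q)‖ ≤
      2048 / (δ ^ 3 * (r - dist s c - 2 * ε) ^ 4) := (norm_sum_le _ _).trans hE
  -- (5) reference truncation, and the h-form of the truncated reference force
  have hT := norm_refForce_sub_trunc_le hA hI hs (by linarith) SR hSR
  have hform : ∑ q ∈ SR.erase s, (deriv lennardJones (dist s q) / dist s q) • (s - q) =
      ∑ s' ∈ SR.erase s, (-((‖s - s'‖ ^ 2)⁻¹) ^ 7 + ((‖s - s'‖ ^ 2)⁻¹) ^ 4) • (s - s') := by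
    refine Finset.sum_congr rfl fun s' hs' => ?_
    have hne : s ≠ s' := (Finset.ne_of_mem_erase hs').symm
    rw [dist_eq_norm, ljForce_eq_smul (sub_ne_zero.2 hne)]
  rw [hform] at hT
  -- (6) assemble: F∞ = (F∞ − Fr) + (Fr + Lu + E) − Lu − E
  set Finf := ∑' q : {q : EuclideanSpace ℝ (Fin 3) // q ∈ Sites₀ t A ∧ q ≠ s},
    (deriv lennardJones (dist s q) / dist s q) • (s - (q : EuclideanSpace ℝ (Fin 3))) with hFinf
  set Fr := ∑ s' ∈ SR.erase s, (-((‖s - s'‖ ^ 2)⁻¹) ^ 7 + ((‖s - s'‖ ^ 2)⁻¹) ^ 4) • (s - s') with hFr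
  set Lu := ∑ s' ∈ SR.erase s,
      ((-((‖s - s'‖ ^ 2)⁻¹) ^ 7 + ((‖s - s'‖ ^ 2)⁻¹) ^ 4) • ((π s - s) - (π s' - s')) +
        (2 * ⟪s - s', (π s - s) - (π s' - s')⟫ *
          (7 * ((‖s - s'‖ ^ 2)⁻¹) ^ 8 - 4 * ((‖s - s'‖ ^ 2)⁻¹) ^ 5)) • (s - s')) with hLu
  set E := ∑ q ∈ Rest, (deriv lennardJones (dist (π s) q) / dist (π s) q) • (π s - q) with hEdef
  have hdecomp : Finf = (Finf - Fr) + (Fr + Lu + E) - Lu - E := by abel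
  calc ‖Finf‖ = ‖(Finf - Fr) + (Fr + Lu + E) - Lu - E‖ := by rw [← hdecomp]
    _ ≤ ‖Finf - Fr‖ + ‖Fr + Lu + E‖ + ‖Lu‖ + ‖E‖ := by
        have h1 := norm_sub_le ((Finf - Fr) + (Fr + Lu + E) - Lu) E
        have h2 := norm_sub_le ((Finf - Fr) + (Fr + Lu + E)) Lu
        have h3 := norm_add_le (Finf - Fr) (Fr + Lu + E)
        linarith
    _ ≤ 2048 / ((23 / 25 : ℝ) ^ 3 * (r - dist s c) ^ 4) +
        6000 * (2 * ε) ^ 2 * (1024 / ((23 / 25 : ℝ) ^ 3 * (23 / 25 : ℝ) ^ 6)) +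
        76 * ε * (1024 / ((23 / 25 : ℝ) ^ 3 * (23 / 25 : ℝ) ^ 5)) +
        2048 / (δ ^ 3 * (r - dist s c - 2 * ε) ^ 4) := by
        linarith [hT, hlin.trans hN, hL', hE']

end

end Summit.AtomisticToContinuum.Crystallization.Theorems.ExcessDecayLiouville

end
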